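import Literature.LinearAlgebra.QuadraticForm.PosComplexStructuresConnected
import Mathlib.RingTheory.Complex
import HarnessLib

/-!
# RSZ's `h_{G^ℚ,φ}(√−1) = √−1 J_φ` is a point of Deligne's period domain `X⁺(φ(√Δ), Tr_{ℂ/ℝ}(φ(√Δ)⁻¹(·,·)_φ))`:
# the archimedean component of the unitary PEL datum lies in the tree's `posComplexStructures`, which is therefore
# non-empty and path connected

Topic `NumberTheory/Automorphic`, namespace `Literature.NumberTheory.Automorphic.UnitaryShimuraDatum` (lane
`lit-hodgefound`, Track 2 foundations; seat `lit-hodgefound-p11`, generation 31, row g31-#3).  THEOREMS ONLY (D-0026):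
no definition, no named fact, no instance, no notation.  A BRIDGE between Layer C (the Shimura homomorphisms of
[RapoportSmithlingZhang2017] §3.1 on real points — companion file `Automorphic/UnitaryShimuraHomomorphisms`, g31-#2,
not imported) and the tree's Layer-A/B period-domain files ✔ `LinearAlgebra/QuadraticForm/PositiveProjections`
(`posComplexStructures k ψ` = Deligne's `X⁺`: `J² = −1`, `J k = k J`, `ψ(Jx, Jy) = ψ(x, y)`, `ψ(x, Jx) > 0`) and
✔ `…/PosComplexStructuresConnected` (`isPathConnected_posComplexStructures`: `X⁺` is path connected when non-empty).

## The print, verbatim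

[RapoportSmithlingZhang2017] §3.1 (held text `paper:arxiv-1710.06962` p0009 L14–L45) with Notation p0006 L10–L12: «the
hermitian forms on `W_φ` […] have respective normal forms `(x, y)_φ = ᵗx J_φ ȳ` […]. We then define the component maps
`h_{G^ℚ,φ} : ℂ^× → GU(W_φ)(ℝ)` […] to be induced by the respective `ℝ`-algebra homomorphisms `ℂ → End(W_φ)`,
`√−1 ↦ √−1 J_φ` […]. By definition of `Φ`, the form `⟨x, y⟩_φ := Tr_{ℂ/ℝ}(φ(√Δ))⁻¹(h_{G^ℚ,φ}(√−1) x, y)_φ` is symmetric and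
positive definite on `W_φ` for each `φ ∈ Φ`»; «`Φ := {φ : F → ℂ | φ(√Δ) ∈ ℝ_{>0} · √−1}`».  Remark 3.2 (p0010 L18–L22):
«The conjugacy class `{h_{G,φ₀}}` then identifies with the open subset `𝒟_{φ₀} ⊂ ℙ(W_{φ₀})(ℂ)` of positive-definite
lines […] (send `h` to the `−1`-eigenspace of `h(√−1)`; […] `𝒟_{φ₀}` is also isomorphic to the open unit ball in
`ℂ^{n−1}`).»

[Deligne1982HodgeCycles] proof of Thm. 4.8, pp. 48–49 (the tree's `posComplexStructures`, quoted in
`QuadraticForm/PositiveProjections`): «(a′) `J` commutes with the action of `E`; (b′) `ψ(x, Jy)` is symmetric and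
positive definite […] `X⁺` […] is an open connected complex submanifold of a Grassmannian».

## The dictionary (any signature: `J = diag(s)`, `sᵢ = ±1`; `V = W_φ ⊗ ℝ = ℂ^m` as a REAL space)

RSZ's alternating form on `W` is `⟨x, y⟩ = Tr_{F/ℚ}((√Δ)⁻¹ (x, y))`; at the place `φ`, with `ρ := φ(√Δ) = √−1 r`, `r > 0`,
the operator `k = ρ·` («the action of `E`», `k² = −r²`) and the REAL bilinear form
`B(u, v) := Tr_{ℂ/ℝ}(ρ⁻¹ (v, u)_φ)`, `(a, b)_φ = Σᵢ sᵢ aᵢ b̄ᵢ` (the orientation for which Deligne's `B(x, Jx) > 0` IS RSZ's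
`⟨x, x⟩_φ > 0`: `B(x, J₀x) = Tr(ρ⁻¹(J₀x, x)) = ⟨x, x⟩_φ`), and `J₀ := h_{G^ℚ,φ}(√−1) = √−1 J_φ` acting on `V`.  The operators
and the form enter through their defining formulas (`hk : k x = ρ • x`, `hJ₀ : J₀ x = (√−1 J) x`, `hB`); §1 shows such
`k`, `J₀`, `B` EXIST as continuous linear maps / an `ℝ`-bilinear form on the finite-dimensional real space `m → ℂ`.

* §1 `exists_clm_smul`, `exists_clm_mulVec`, **`exists_bilinForm_trace`** (the carriers), `clm_smul_mul_self`
  (`k² = −r² · 1`), **`bilinForm_trace_skew`** (`B(kx, y) = −B(x, ky)` — compatibility (a′) with the `E`-action),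
  **`bilinForm_trace_isAlt`** (`B` is alternating, for `ρ` purely imaginary and `J = diag(±1)`).
* §2 `dotProduct_mulVec_I_smul_star` (`(J(√−1 J)a, \overline{(√−1 J) b}) = (Ja, b̄)` for `sᵢ = ±1`),
  `trace_inv_mul_pairing_I_smul_self` (RSZ's positivity `Tr((√−1 r)⁻¹ (J(√−1 J) x, x̄)) = (2/r) Σ|xᵢ|²`, re-proved here in a
  few lines so that this file does not depend on g31-#2), and the MAIN THEOREM **`I_smul_mem_posComplexStructures`**:
  `J₀ = √−1 J_φ ∈ X⁺(k, B)` — `J₀² = −1`, `J₀ k = k J₀`, `B(J₀u, J₀v) = B(u, v)`, `B(x, J₀x) = ⟨x, x⟩_φ > 0`.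
* §3 consequences BY NAME from the tree: **`posComplexStructures_trace_nonempty`**,
  **`isPathConnected_posComplexStructures_trace`** (Deligne's «`X⁺` […] connected» for the datum of every `φ ∈ Φ`, through
  ✔ `isPathConnected_posComplexStructures`), `unitCx_eq_I_smul` (the tree's normalised complex unit `i = k/√(r²)` IS
  multiplication by `√−1`), and **`apply_eq_unitCx_iff`** (Deligne's `+i`-eigenspace `W₊ = {J₀ = i}` — the `−1`-eigenspace of
  `h_{G,φ}(√−1)` in Remark 3.2's projective reading — is `{x : xᵢ = 0 whenever sᵢ = −1}`, the span of the POSITIVE basis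
  vectors: for `J_{φ₀} = diag(1, −1, …, −1)` the line `ℂ e_{i₀}`, for `J_φ = −1` zero).

Not formalised: `X⁺ ≅ 𝒟_{φ₀} ≅` the unit ball, `X⁺ = U(1, n−1)/U(1) × U(n−1)` (the tree's `Motives/RealWeilDatumPeriodDomain`
has the homogeneous-space statement for its own datum), the family of abelian varieties over `X⁺`.

## References

* [RapoportSmithlingZhang2017] M. Rapoport, B. Smithling, W. Zhang, *Arithmetic diagonal cycles on unitary Shimura
  varieties*, Compositio Math. 156 (2020) = arXiv 1710.06962, §3.1, Remark 3.2.
* [Deligne1982HodgeCycles] P. Deligne (notes by J. S. Milne), *Hodge cycles on abelian varieties*, LNM 900 (1982), proof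
  of Thm. 4.8, pp. 48–49.
* [Kottwitz1992] R. E. Kottwitz, *Points on some Shimura varieties over finite fields*, J. Amer. Math. Soc. 5 (1992), §4
  Lemma 4.1, pp. 386–389 (`X_∞`, «`(v, h(i)w)` positive definite»).
-/

open scoped Matrix ComplexConjugate

namespace Literature.NumberTheory.Automorphic.UnitaryShimuraDatum

open Complex Matrix Literature.LinearAlgebra.QuadraticForm

variable {m : Type*} [Fintype m] [DecidableEq m]

/-! ## §1 The carriers on the real space `V = ℂ^m`: `k = ρ·`, `J₀ = M·`, `B(u, v) = Tr_{ℂ/ℝ}(ρ⁻¹ (v, u)_J)` -/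

omit [Fintype m] [DecidableEq m] in
/-- Multiplication by a complex scalar `ρ` is a continuous `ℝ`-linear operator of `ℂ^m` («the action of `E`» on
`W_φ ⊗ ℝ`). [cite: RapoportSmithlingZhang2017, §3.1] -/
theorem exists_clm_smul (ρ : ℂ) : ∃ k : (m → ℂ) →L[ℝ] (m → ℂ), ∀ x, k x = ρ • x :=
  ⟨((ρ • ContinuousLinearMap.id ℂ (m → ℂ)).restrictScalars ℝ), fun _ => rfl⟩

/-- A complex matrix acts as a continuous `ℝ`-linear operator of `ℂ^m` (here: `√−1 J_φ = h_{G^ℚ,φ}(√−1)`).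
[cite: RapoportSmithlingZhang2017, §3.1] -/
theorem exists_clm_mulVec (M : Matrix m m ℂ) : ∃ T : (m → ℂ) →L[ℝ] (m → ℂ), ∀ x, T x = M *ᵥ x :=
  ⟨LinearMap.toContinuousLinearMap ((Matrix.toLin' M).restrictScalars ℝ), fun x => Matrix.toLin'_apply M x⟩

omit [DecidableEq m] in
/-- **The real bilinear form `B(u, v) = Tr_{ℂ/ℝ}(ρ⁻¹ (v, u)_J)`**, `(a, b)_J = Σ (J a)ᵢ b̄ᵢ`, exists as an `ℝ`-bilinear form
on `ℂ^m` — the `φ`-component of RSZ's alternating form `Tr_{F/ℚ}((√Δ)⁻¹(x, y))` on `W`, in Deligne's orientation.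
[cite: RapoportSmithlingZhang2017, §3.1] -/
theorem exists_bilinForm_trace (ρ : ℂ) (J : Matrix m m ℂ) :
    ∃ B : LinearMap.BilinForm ℝ (m → ℂ), ∀ u v,
      B u v = Algebra.trace ℝ ℂ (ρ⁻¹ * dotProduct (J *ᵥ v) (star u)) := by
  refine ⟨LinearMap.mk₂ ℝ (fun u v => Algebra.trace ℝ ℂ (ρ⁻¹ * dotProduct (J *ᵥ v) (star u)))
    (fun u₁ u₂ v => ?_) (fun c u v => ?_) (fun u v₁ v₂ => ?_) (fun c u v => ?_), fun u v => rfl⟩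
  · simp only [star_add, dotProduct_add, mul_add, map_add]
  · simp only [star_smul, star_trivial, dotProduct_smul, mul_smul_comm, map_smul]
  · simp only [Matrix.mulVec_add, add_dotProduct, mul_add, map_add]
  · simp only [Matrix.mulVec_smul, smul_dotProduct, mul_smul_comm, map_smul]

omit [Fintype m] [DecidableEq m] in
/-- `k² = −r² · 1` for `k = (√−1 r)·`: the hypothesis `k * k = -(d • 1)` of the tree's `X⁺` files with `d = r²`.
[cite: Deligne1982HodgeCycles, proof of Thm. 4.8, p. 48] -/
theorem clm_smul_mul_self {r : ℝ} {k : (m → ℂ) →L[ℝ] (m → ℂ)} (hk : ∀ x, k x = (I * r) • x) :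
    k * k = -((r ^ 2) • (1 : (m → ℂ) →L[ℝ] (m → ℂ))) := by
  have h : (I * r) * (I * r) = -((r ^ 2 : ℝ) : ℂ) := by
    rw [mul_mul_mul_comm, I_mul_I, Complex.ofReal_pow]; ring
  ext x i
  change k (k x) i = (-((r ^ 2 : ℝ) • x)) i
  rw [hk, hk, smul_smul, h, Pi.neg_apply, Pi.smul_apply, Pi.smul_apply, smul_eq_mul, Complex.real_smul, neg_mul]

omit [DecidableEq m] in
/-- **(a′) compatibility with the `E`-action: `B(kx, y) = −B(x, ky)`** for `k = ρ·`, `ρ = √−1 r` purely imaginary: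
`(y, ρx) = ρ̄ (y, x) = −ρ (y, x)` while `(ρy, x) = ρ (y, x)`. [cite: Deligne1982HodgeCycles, proof of Thm. 4.8, p. 48]
[cite: RapoportSmithlingZhang2017, §3.1] -/
theorem bilinForm_trace_skew {r : ℝ} (J : Matrix m m ℂ) {k : (m → ℂ) →L[ℝ] (m → ℂ)} (hk : ∀ x, k x = (I * r) • x)
    {B : LinearMap.BilinForm ℝ (m → ℂ)}
    (hB : ∀ u v, B u v = Algebra.trace ℝ ℂ ((I * r)⁻¹ * dotProduct (J *ᵥ v) (star u))) (x y : m → ℂ) :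
    B (k x) y = -B x (k y) := by
  rw [hB, hB, hk, hk, star_smul, dotProduct_smul, Matrix.mulVec_smul, smul_dotProduct, ← map_neg]
  congr 1
  simp only [smul_eq_mul, Complex.star_def, map_mul, Complex.conj_I, Complex.conj_ofReal]
  ring

/-- `(Ja, b̄)` with `J = diag(s)`: `Σ sᵢ aᵢ b̄ᵢ`. [folklore] -/
private theorem dotProduct_diagonal_mulVec_star (s a b : m → ℂ) :
    dotProduct (Matrix.diagonal s *ᵥ a) (star b) = ∑ i, s i * a i * conj (b i) := by
  rw [dotProduct]
  exact Finset.sum_congr rfl fun i _ => by rw [Matrix.mulVec_diagonal, Pi.star_apply, Complex.star_def]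

/-- `(x, x)_J = Σ sᵢ |xᵢ|²` is REAL for real signs `sᵢ = ±1`. [folklore] -/
private theorem conj_pairing_self {s : m → ℂ} (hs : ∀ i, s i = 1 ∨ s i = -1) (x : m → ℂ) :
    conj (dotProduct (Matrix.diagonal s *ᵥ x) (star x)) = dotProduct (Matrix.diagonal s *ᵥ x) (star x) := by
  rw [dotProduct_diagonal_mulVec_star, map_sum]
  refine Finset.sum_congr rfl fun i _ => ?_
  have hsi : conj (s i) = s i := by rcases hs i with h | h <;> rw [h] <;> simp
  rw [map_mul, map_mul, hsi, Complex.conj_conj, mul_assoc, mul_assoc, mul_comm (conj (x i))]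

/-- **`B` is alternating**: `B(x, x) = Tr_{ℂ/ℝ}(ρ⁻¹ (x, x)) = 0`, as `(x, x) = Σ sᵢ|xᵢ|²` is real and `ρ⁻¹ = −√−1/r` purely
imaginary (RSZ: `(√Δ)⁻¹(x, y)` is `F/F₀`-anti-hermitian, so its trace form is alternating).
[cite: RapoportSmithlingZhang2017, §3.1] -/
theorem bilinForm_trace_isAlt {r : ℝ} {s : m → ℂ} (hs : ∀ i, s i = 1 ∨ s i = -1) {J : Matrix m m ℂ}
    (hJ : J = Matrix.diagonal s) {B : LinearMap.BilinForm ℝ (m → ℂ)}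
    (hB : ∀ u v, B u v = Algebra.trace ℝ ℂ ((I * r)⁻¹ * dotProduct (J *ᵥ v) (star u))) : B.IsAlt := by
  intro x
  rw [hB, Algebra.trace_complex_apply, hJ]
  have hre : ((I * r)⁻¹ * dotProduct (Matrix.diagonal s *ᵥ x) (star x)).re = 0 := by
    have hreal := conj_pairing_self hs x
    rw [Complex.conj_eq_iff_im] at hreal
    rw [Complex.mul_re, hreal, mul_zero, sub_zero, mul_inv, Complex.inv_I, neg_mul, Complex.neg_re,
      ← Complex.ofReal_inv, Complex.re_mul_ofReal, Complex.I_re, zero_mul, neg_zero, zero_mul]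
  rw [hre, mul_zero]

/-! ## §2 `J₀ = √−1 J_φ` is a point of `X⁺(k, B)` -/

/-- **Invariance**: `(J(√−1 J)a, \overline{(√−1 J)b}) = (Ja, b̄)` for `J = diag(s)`, `sᵢ = ±1` — `h(√−1)` preserves
`(·,·)_φ` up to its multiplier `|√−1|² = 1`. [cite: RapoportSmithlingZhang2017, §3.1] -/
theorem dotProduct_mulVec_I_smul_star {s : m → ℂ} (hs : ∀ i, s i = 1 ∨ s i = -1) {J : Matrix m m ℂ}
    (hJ : J = Matrix.diagonal s) (a b : m → ℂ) :
    dotProduct (J *ᵥ ((I • J) *ᵥ a)) (star ((I • J) *ᵥ b)) = dotProduct (J *ᵥ a) (star b) := by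
  subst hJ
  rw [dotProduct, dotProduct]
  refine Finset.sum_congr rfl fun i _ => ?_
  have hss : s i * s i = 1 := by rcases hs i with h | h <;> rw [h] <;> norm_num
  have hsi : conj (s i) = s i := by rcases hs i with h | h <;> rw [h] <;> simp
  simp only [Matrix.smul_mulVec, Pi.smul_apply, Matrix.mulVec_diagonal, smul_eq_mul, Pi.star_apply,
    Complex.star_def, map_mul, Complex.conj_I, hsi]
  linear_combination (s i * a i * conj (b i)) * hss + (-(s i ^ 3 * a i * conj (b i))) * Complex.I_mul_I

/-- **RSZ's positivity, computed**: `Tr_{ℂ/ℝ}((√−1 r)⁻¹ (J(√−1 J)x, x̄)) = (2/r) Σ |xᵢ|²` (`J = diag(±1)`).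
[cite: RapoportSmithlingZhang2017, §3.1] -/
theorem trace_inv_mul_pairing_I_smul_self {s : m → ℂ} (hs : ∀ i, s i = 1 ∨ s i = -1) {J : Matrix m m ℂ}
    (hJ : J = Matrix.diagonal s) (r : ℝ) (x : m → ℂ) :
    Algebra.trace ℝ ℂ ((I * r)⁻¹ * dotProduct (J *ᵥ ((I • J) *ᵥ x)) (star x)) = 2 * r⁻¹ * ∑ i, Complex.normSq (x i) := by
  subst hJ
  have hJJ : Matrix.diagonal s * Matrix.diagonal s = 1 := by
    rw [Matrix.diagonal_mul_diagonal, ← Matrix.diagonal_one]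
    congr 1; funext i
    rcases hs i with h | h <;> rw [h] <;> norm_num
  have hdot : dotProduct (Matrix.diagonal s *ᵥ ((I • Matrix.diagonal s) *ᵥ x)) (star x) =
      I * ((∑ i, Complex.normSq (x i) : ℝ) : ℂ) := by
    rw [Matrix.smul_mulVec, Matrix.mulVec_smul, Matrix.mulVec_mulVec, hJJ, Matrix.one_mulVec, smul_dotProduct,
      smul_eq_mul, dotProduct, Complex.ofReal_sum]
    congr 1
    exact Finset.sum_congr rfl fun i _ => Complex.mul_conj (x i)
  rw [hdot, Algebra.trace_complex_apply]
  by_cases hr : r = 0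
  · subst hr; simp
  · rw [mul_inv, mul_mul_mul_comm, inv_mul_cancel₀ Complex.I_ne_zero, one_mul, ← Complex.ofReal_inv,
      Complex.re_ofReal_mul, mul_assoc, Complex.ofReal_re]

omit [DecidableEq m] in
/-- `0 < Σ |xᵢ|²` for `x ≠ 0`. [folklore] -/
private theorem sum_normSq_pos' {x : m → ℂ} (hx : x ≠ 0) : 0 < ∑ i, Complex.normSq (x i) := by
  obtain ⟨i, hi⟩ : ∃ i, x i ≠ 0 := by
    by_contra h
    push Not at h
    exact hx (funext h)
  exact Finset.sum_pos' (fun j _ => Complex.normSq_nonneg _) ⟨i, Finset.mem_univ _, Complex.normSq_pos.2 hi⟩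

/-- **MAIN THEOREM — `h_{G^ℚ,φ}(√−1) = √−1 J_φ` is a point of Deligne's `X⁺(k, B)`** (the tree's
`posComplexStructures k B`) for `k = φ(√Δ)· = (√−1 r)·` with `r > 0` (i.e. `φ ∈ Φ`) and
`B(u, v) = Tr_{ℂ/ℝ}(φ(√Δ)⁻¹ (v, u)_φ)`, ANY signature `J_φ = diag(±1)`: `J₀² = −1`; `J₀` commutes with the `E`-action;
`B(J₀u, J₀v) = B(u, v)`; `B(x, J₀x) = ⟨x, x⟩_φ > 0` — «symmetric and positive definite … by definition of `Φ`».
[cite: RapoportSmithlingZhang2017, §3.1] [cite: Deligne1982HodgeCycles, proof of Thm. 4.8, pp. 48–49] -/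
theorem I_smul_mem_posComplexStructures {r : ℝ} (hr : 0 < r) {s : m → ℂ} (hs : ∀ i, s i = 1 ∨ s i = -1)
    {J : Matrix m m ℂ} (hJ : J = Matrix.diagonal s) {k J₀ : (m → ℂ) →L[ℝ] (m → ℂ)} (hk : ∀ x, k x = (I * r) • x)
    (hJ₀ : ∀ x, J₀ x = (I • J) *ᵥ x) {B : LinearMap.BilinForm ℝ (m → ℂ)}
    (hB : ∀ u v, B u v = Algebra.trace ℝ ℂ ((I * r)⁻¹ * dotProduct (J *ᵥ v) (star u))) :
    J₀ ∈ posComplexStructures k B := by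
  have hJJ : J * J = 1 := by
    rw [hJ, Matrix.diagonal_mul_diagonal, ← Matrix.diagonal_one]
    congr 1; funext i
    rcases hs i with h | h <;> rw [h] <;> norm_num
  have hIJ : (I • J) * (I • J) = -1 := by
    rw [Matrix.smul_mul, Matrix.mul_smul, smul_smul, hJJ, I_mul_I, neg_smul, one_smul]
  refine ⟨?_, ?_, fun u v => ?_, fun x hx => ?_⟩
  · ext x i
    change J₀ (J₀ x) i = (-x) i
    rw [hJ₀, hJ₀, Matrix.mulVec_mulVec, hIJ, Matrix.neg_mulVec, Matrix.one_mulVec]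
  · ext x i
    change J₀ (k x) i = k (J₀ x) i
    rw [hJ₀, hk, hk, hJ₀, Matrix.mulVec_smul]
  · rw [hB, hB, hJ₀, hJ₀, dotProduct_mulVec_I_smul_star hs hJ]
  · rw [hB, hJ₀, trace_inv_mul_pairing_I_smul_self hs hJ]
    exact mul_pos (mul_pos two_pos (inv_pos.2 hr)) (sum_normSq_pos' hx)

/-! ## §3 Consequences from the tree: `X⁺` non-empty and path connected; the `+i`-eigenspace of `J₀` -/

/-- **`X⁺(k, B)` is NON-EMPTY** for RSZ's datum at every `φ ∈ Φ` — it contains `h_{G^ℚ,φ}(√−1)`.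
[cite: RapoportSmithlingZhang2017, §3.1] -/
theorem posComplexStructures_trace_nonempty {r : ℝ} (hr : 0 < r) {s : m → ℂ} (hs : ∀ i, s i = 1 ∨ s i = -1)
    {J : Matrix m m ℂ} (hJ : J = Matrix.diagonal s) {k : (m → ℂ) →L[ℝ] (m → ℂ)} (hk : ∀ x, k x = (I * r) • x)
    {B : LinearMap.BilinForm ℝ (m → ℂ)}
    (hB : ∀ u v, B u v = Algebra.trace ℝ ℂ ((I * r)⁻¹ * dotProduct (J *ᵥ v) (star u))) :
    (posComplexStructures k B).Nonempty := by
  obtain ⟨J₀, hJ₀⟩ := exists_clm_mulVec (I • J)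
  exact ⟨J₀, I_smul_mem_posComplexStructures hr hs hJ hk hJ₀ hB⟩

/-- **Deligne's «`X⁺` is connected» for RSZ's archimedean datum**: the period domain `X⁺(φ(√Δ), Tr(φ(√Δ)⁻¹(·,·)_φ))`
is PATH CONNECTED (✔ `isPathConnected_posComplexStructures` of the tree, fed with `k² = −r²`, `B` alternating,
`B(kx, y) = −B(x, ky)` and the point `√−1 J_φ`). [cite: Deligne1982HodgeCycles, proof of Thm. 4.8, p. 49]
[cite: RapoportSmithlingZhang2017, Remark 3.2] -/
theorem isPathConnected_posComplexStructures_trace {r : ℝ} (hr : 0 < r) {s : m → ℂ}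
    (hs : ∀ i, s i = 1 ∨ s i = -1) {J : Matrix m m ℂ} (hJ : J = Matrix.diagonal s)
    {k : (m → ℂ) →L[ℝ] (m → ℂ)} (hk : ∀ x, k x = (I * r) • x) {B : LinearMap.BilinForm ℝ (m → ℂ)}
    (hB : ∀ u v, B u v = Algebra.trace ℝ ℂ ((I * r)⁻¹ * dotProduct (J *ᵥ v) (star u))) :
    IsPathConnected (posComplexStructures k B) :=
  isPathConnected_posComplexStructures (pow_pos hr 2) (clm_smul_mul_self hk) (bilinForm_trace_isAlt hs hJ hB)
    (bilinForm_trace_skew J hk hB) (posComplexStructures_trace_nonempty hr hs hJ hk hB)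

omit [DecidableEq m] in
/-- The tree's normalised complex unit `i = d^{−1/2} k` (`unitCx k d`, `d = r²`) IS multiplication by `√−1`.
[cite: Deligne1982HodgeCycles, proof of Thm. 4.8, p. 49] -/
theorem unitCx_eq_I_smul {r : ℝ} (hr : 0 < r) {k : (m → ℂ) →L[ℝ] (m → ℂ)} (hk : ∀ x, k x = (I * r) • x)
    (x : m → ℂ) : unitCx k (r ^ 2) x = I • x := by
  rw [unitCx_apply, hk, Real.sqrt_sq hr.le, ← algebraMap_smul ℂ r⁻¹ ((I * (r : ℂ)) • x), smul_smul, map_inv₀,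
    Complex.coe_algebraMap, mul_comm I (r : ℂ), ← mul_assoc, inv_mul_cancel₀ (Complex.ofReal_ne_zero.2 hr.ne'),
    one_mul]

/-- **The `+i`-eigenspace `W₊ = {J₀ x = i x}` of Deligne (`= H^{1,0}`) is the span of the POSITIVE basis vectors**:
`√−1 J x = √−1 x ⟺ J x = x ⟺ xᵢ = 0` whenever `sᵢ = −1`.  For `J_{φ₀} = diag(1, −1, …, −1)` this is the line
`ℂ e_{i₀}` — Remark 3.2's positive-definite line attached to `h_{G,φ₀}` (the `−1`-eigenspace of
`h_{G,φ₀}(√−1) = diag(−1, 1, …, 1)`); for `J_φ = −1` it is `0` (`{h_{G,φ}}` is a point).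
[cite: RapoportSmithlingZhang2017, Remark 3.2] [cite: Deligne1982HodgeCycles, proof of Thm. 4.8, p. 49] -/
theorem apply_eq_unitCx_iff {r : ℝ} (hr : 0 < r) {s : m → ℂ} (hs : ∀ i, s i = 1 ∨ s i = -1)
    {J : Matrix m m ℂ} (hJ : J = Matrix.diagonal s) {k J₀ : (m → ℂ) →L[ℝ] (m → ℂ)} (hk : ∀ x, k x = (I * r) • x)
    (hJ₀ : ∀ x, J₀ x = (I • J) *ᵥ x) (x : m → ℂ) :
    J₀ x = unitCx k (r ^ 2) x ↔ ∀ i, s i = -1 → x i = 0 := by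
  rw [unitCx_eq_I_smul hr hk, hJ₀, hJ, Matrix.smul_mulVec]
  constructor
  · intro h i hi
    have h' := congrFun h i
    rw [Pi.smul_apply, Pi.smul_apply, Matrix.mulVec_diagonal, hi, smul_eq_mul, smul_eq_mul, neg_one_mul, mul_neg,
      neg_eq_iff_add_eq_zero, ← two_mul] at h'
    exact (mul_eq_zero.1 ((mul_eq_zero.1 h').resolve_left two_ne_zero)).resolve_left Complex.I_ne_zero
  · intro h
    funext i
    rw [Pi.smul_apply, Pi.smul_apply, Matrix.mulVec_diagonal]
    rcases hs i with hi | hi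
    · rw [hi, one_mul]
    · rw [h i hi, mul_zero, smul_zero]

end Literature.NumberTheory.Automorphic.UnitaryShimuraDatum
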